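import Summits.Langlands.Langlands.Theses.QuarterDeficit1951
import Summits.Langlands.Langlands.Theorems.QuarterDeficit1951CensusDecoding
import Summits.Langlands.Langlands.Theorems.QuarterDeficit1951WindowFormDictionary
import Summits.Langlands.Langlands.Theorems.QuarterDeficit1951CorrespondentFingerprint
import Summits.Langlands.Langlands.Theorems.QuarterDeficit1951IcosahedralSupply
import Summits.Langlands.Langlands.Theorems.CensusDeficit1951.Negative.CensusDeficit1951FalseOfOddWindowCertificate
import Summits.Langlands.Langlands.Theorems.QuarterDeficit1951CensusDeficit1951Calibration

/-!
# STRATEGY-CENSUS r1 — typed companions (crux `CensusDeficit1951`, stmt-Langlands-17933)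

Redirect crux-strategist r1 (`planner-cstrat-stmt-Langlands-17933-r1-0`, second opinion), 2026-08-17.
Scratch file accompanying `Cruxes/CensusDeficit1951/STRATEGY-CENSUS.md` (r1 section). Nothing here is a
line or a stub. It supplies the kernel-checked statements the census quotes:

§1 **The summit instance that owns `¬D`.** `EvenIcosahedral1951Reciprocity` := conjunct (B) of the typed
   summit at `F = ℚ`, `n = 2`, `ℓ = 17`, restricted to the Doud–Moore hypotheses (irreducible, finite image,
   EVEN, Artin conductor `1951`, order-5 determinant, icosahedral Frobenius data) — the even icosahedral case
   of the strong Artin conjecture for ONE reciprocity datum. Arrows, all sorry-free: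
   `Langlands → GL2GaloisToAutomorphicQ → EvenIcosahedral1951Reciprocity → ¬ CensusDeficit1951`
   (the last through the route's four PROVED items), and the contrapositive
   `CensusDeficit1951 → ¬ EvenIcosahedral1951Reciprocity`: proving the crux REFUTES the narrowest summit
   instance (numerically corroborated to 12 digits at 1951), and the only theoretical source of `¬D` in print
   is that instance (census §Transfer/§Negation; Booker 2003: weak Artin ⟺ strong Artin here, so "L(s,ρ) entire"
   does not separate either).
§2 **Decomposition attempt D-r1 (format dichotomy as a conjunctive split), typed and glued.**
   `ResolvingCensus1951` (A: every order-5 `χ` admits a certified transcript at the crux's constants that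
   RESOLVES the window, `U ≤ 1`, with all six primes fingerprinted) and `ViolationOfResolvedLine1951`
   (B: every such resolving transcript that sees one line sees a certified violation) with
   `censusDeficit1951_of_resolving_of_violation : A → B → D` PROVED. Not filed as `route edit --split`:
   A is TRUE but provable in-kernel only with complete joint spectral data (`IsJointSpectralData`, the cuspidal
   spectral theorem of `L²(Γ₀(1951)\ℍ, χ)` plus a band-limited resolving test function), and `¬B` needs to
   EXHIBIT a certified transcript — strictly MORE than `¬D` (one fingerprinted window form, p158485) — so the
   split isolates nothing cheaper on either side (census §Decomposition).
§3 Bookkeeping used by the census: `not_censusDeficit1951_of_oddWindowCertificate'` (= p161038, re-exported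
   by name for the tribunal's closing motion) and the two-sided calibration quoted from p164134.
-/

set_option linter.dupNamespace false

noncomputable section

namespace Summit.Langlands.Langlands.Cruxes.CensusDeficit1951.CensusR1

open Literature.NumberTheory.Automorphic
open Literature.NumberTheory.GaloisRepresentations
open Summit.Langlands
open Summit.Langlands.Langlands.Theses.QuarterDeficit1951
open Summit.Langlands.Langlands.Theorems.QuarterDeficit1951
  (CensusDecoding_proof WindowFormDictionary_proof IcosahedralSupply_proof)
open Summit.Langlands.Langlands.Theorems.CorrespondentFingerprint (CorrespondentFingerprint_proof)
open Summit.Langlands.Langlands.Theorems.CensusDeficit1951.Negative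
  (CensusDeficit1951_false_of_OddWindowCertificate)
open Summit.Langlands.Langlands.Theorems.QuarterFingerprintDeficit.Negative (OddWindowCertificate)

instance fact_prime_17 : Fact (Nat.Prime 17) := ⟨by norm_num⟩

/-! ## §1 The summit instance that owns `¬D` -/

/-- The Doud–Moore hypotheses on a framed `ℓ`-adic representation `ρ` of `Γ_ℚ` (verbatim the hypothesis
block of the route items `CorrespondentFingerprint` / `IcosahedralSupply`): irreducible, finite image, even,
Artin conductor `1951`, determinant described by an order-5 character mod `1951` at arithmetic Frobenius,
icosahedral Frobenius data `t²/d ∈ {0, 1, 4, roots of x² − 3x + 1}` away from `1951`. [cite: DoudMoore2006] -/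
def IsDoudMooreRep {ℓ : ℕ} [Fact ℓ.Prime] (ι : PadicAlgCl ℓ ≃+* ℂ)
    (ρ : FramedGaloisRep ℚ (PadicAlgCl ℓ) 2) : Prop :=
  ρ.toGaloisRep.IsIrreducible ∧ (Set.range ρ).Finite ∧ ρ.IsEven ∧ ρ.toGaloisRep.artinConductorNat = 1951 ∧
    ∃ χ₀ : DirichletCharacter ℂ 1951, orderOf χ₀ = 5 ∧
      ∀ v : IsDedekindDomain.HeightOneSpectrum (NumberField.RingOfIntegers ℚ), v.residueCard ≠ 1951 →
        ρ.IsUnramifiedAt v ∧ ∃ t d : PadicAlgCl ℓ,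
          ρ.HasFrobCharpolyAt v (Polynomial.X ^ 2 - Polynomial.C t * Polynomial.X + Polynomial.C d) ∧
          ι d = (χ₀ (v.residueCard : ZMod 1951))⁻¹ ∧
          (t ^ 2 = 0 ∨ t ^ 2 = d ∨ t ^ 2 = 4 * d ∨ t ^ 4 - 3 * d * t ^ 2 + d ^ 2 = 0)

/-- **Conjunct (B) of the summit at `F = ℚ`, `n = 2`** (Fontaine–Mazur–Langlands for two-dimensional geometric
`ρ` over `ℚ`, every `ℓ`), for SOME reciprocity datum. [cite: FontaineMazurGeometric1995, Conj. 1]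
[cite: BuzzardGeeLMS2014, Conj. 3.2.2] -/
def GL2GaloisToAutomorphicQ : Prop :=
  ∃ RD : ReciprocityData ℚ, GaloisToAutomorphic 2 RD (isCompact_glFiniteIntegralLevel_holds 2 ℚ)

/-- **The even icosahedral instance at conductor 1951** (strong Artin for the Doud–Moore representations,
in the summit's typed vocabulary, at `ℓ = 17`, for SOME reciprocity datum): every Doud–Moore `ρ` that is
geometric for `RD` corresponds at every finite place to a cuspidal L-algebraic `π` of `GL₂(𝔸_ℚ)`.
Open: Booker 2003 (Ann. Math. 158) p. 1090 "no known examples in the even case"; BLS20 §1.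
[cite: Booker2003] [cite: BookerLeeStrombergsson2020, §1] -/
def EvenIcosahedral1951Reciprocity : Prop :=
  ∃ RD : ReciprocityData ℚ, ∀ (ι : PadicAlgCl 17 ≃+* ℂ) (ρ : FramedGaloisRep ℚ (PadicAlgCl 17) 2),
    IsDoudMooreRep ι ρ → IsGeometricFramed RD ρ →
      ∃ π : CuspidalAutomorphicRepData 2 ℚ (isCompact_glFiniteIntegralLevel_holds 2 ℚ),
        π.1.IsLAlgebraic ∧ Corresponds RD ι π.1 ρ

/-- `Langlands` gives conjunct (B) at `(ℚ, 2)` (non-vacuity conjunct supplies the datum). [folklore] -/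
theorem gl2GaloisToAutomorphicQ_of_langlands (hL : _root_.Langlands) : GL2GaloisToAutomorphicQ := by
  obtain ⟨⟨RD⟩, hRD⟩ := hL ℚ
  exact ⟨RD, (hRD RD 2 (by norm_num) (isCompact_glFiniteIntegralLevel_holds 2 ℚ)).2⟩

/-- Conjunct (B) at `(ℚ, 2)` specialises to the even icosahedral instance. [folklore] -/
theorem evenIcosahedral1951Reciprocity_of_gl2 (hB : GL2GaloisToAutomorphicQ) :
    EvenIcosahedral1951Reciprocity := by
  obtain ⟨RD, hRD⟩ := hB
  exact ⟨RD, fun ι ρ hyp hgeo => hRD 17 ι ρ hyp.1 hgeo⟩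

/-- **The summit instance refutes the crux** through the route's four PROVED items: `IcosahedralSupply`
(Doud–Moore `ρ` at `ℓ = 17`, geometric for the given datum), the instance (a correspondent `π`),
`CorrespondentFingerprint` (a fingerprinted `λ = 1/4` Maass newform on `(Γ₀(1951), χ)`, `χ` of order 5), and
`CensusDecoding ∘ WindowFormDictionary` (no certified deficit transcript can coexist with it). [folklore] -/
theorem not_censusDeficit1951_of_evenIcosahedral1951Reciprocity (hI : EvenIcosahedral1951Reciprocity) :
    ¬ CensusDeficit1951 := by
  intro hD
  have h₀ : QuarterFingerprintDeficit := CensusDecoding_proof hD WindowFormDictionary_proof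
  obtain ⟨RD, hRD⟩ := hI
  obtain ⟨ι, ρ, hgeo, hyp⟩ := IcosahedralSupply_proof RD 17 le_rfl
  obtain ⟨π, hLalg, hcorr⟩ := hRD ι ρ hyp hgeo
  obtain ⟨χ, hχ, u, hform, hne, hfp⟩ :=
    CorrespondentFingerprint_proof RD 17 ι _ π ρ le_rfl (by norm_num) hyp hLalg hcorr
  refine h₀ χ hχ ⟨u, 1 / 4, hform, hne, by norm_num, fun p hp => ?_⟩
  obtain ⟨μ, φ, hφ, hT, hμ⟩ := hfp p hp
  exact ⟨μ, φ, hφ, hT, by rw [hμ, sub_self, norm_zero]; norm_num⟩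

/-- Hence `Langlands → ¬D` (the contrapositive of the route's `closes` with its proved co-binders inlined).
[folklore] -/
theorem not_censusDeficit1951_of_langlands (hL : _root_.Langlands) : ¬ CensusDeficit1951 :=
  not_censusDeficit1951_of_evenIcosahedral1951Reciprocity
    (evenIcosahedral1951Reciprocity_of_gl2 (gl2GaloisToAutomorphicQ_of_langlands hL))

/-- **Proving the crux refutes the narrowest summit instance** (even strong Artin at conductor 1951 for
every reciprocity datum). This is what a TRUE-direction line would have to achieve against the
`12`-digit numerical sighting of the predicted forms in all four order-5 spaces. [folklore] -/
theorem not_evenIcosahedral1951Reciprocity_of_censusDeficit1951 (hD : CensusDeficit1951) :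
    ¬ EvenIcosahedral1951Reciprocity :=
  fun hI => not_censusDeficit1951_of_evenIcosahedral1951Reciprocity hI hD

/-! ## §2 Decomposition attempt D-r1: the format dichotomy as a conjunctive split -/

/-- The crux's admissibility clauses on a transcript, with ALL six fingerprint primes present. [folklore] -/
def FullPrimeTranscript (c : MaassHeckeTraceCensus) : Prop :=
  (1 / 100 : ℚ) ≤ c.window ∧ (1 / 100 : ℚ) ≤ c.fpTol ∧
    (∀ p ∈ c.fpPrimes, p ∈ ({2, 3, 5, 7, 11, 13} : Finset ℕ)) ∧
    (∀ p ∈ ({2, 3, 5, 7, 11, 13} : Finset ℕ), p ∈ c.fpPrimes)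

/-- **Piece A — a resolving census exists.** Every order-5 `χ` admits a certified full-prime transcript at
the crux's constants whose upper count is `≤ 1`. TRUE at 1951 (one window line per space, scans k1), but
an in-kernel proof needs complete joint spectral data of `(Γ₀(1951), χ)` and a band-limited test function
separating `r = 0` from the neighbour at `r = 0.1042` (exponential type `≳ 10³`). [folklore] -/
def ResolvingCensus1951 : Prop :=
  ∀ χ : DirichletCharacter ℂ 1951, orderOf χ = 5 →
    ∃ c : MaassHeckeTraceCensus, FullPrimeTranscript c ∧
      CertifiedMaassHeckeTraceCensus 1951 χ c ∧ c.upperCount ≤ 1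

/-- **Piece B — every resolved line is certifiedly off the fingerprint.** For every order-5 `χ`, every
certified full-prime transcript at the crux's constants with `U = 1` records a fingerprint violation at some
prime. Numerically FALSE (the unique window line IS fingerprinted); refuting it in-kernel means EXHIBITING a
certified transcript, i.e. complete spectral data — more than refuting `D`. [folklore] -/
def ViolationOfResolvedLine1951 : Prop :=
  ∀ χ : DirichletCharacter ℂ 1951, orderOf χ = 5 →
    ∀ c : MaassHeckeTraceCensus, FullPrimeTranscript c →
      CertifiedMaassHeckeTraceCensus 1951 χ c → c.upperCount = 1 → c.fpPrimes.any c.violates = true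

/-- **Glue of the split, PROVED**: `A → B → D`. [folklore] -/
theorem censusDeficit1951_of_resolving_of_violation (hA : ResolvingCensus1951)
    (hB : ViolationOfResolvedLine1951) : CensusDeficit1951 := by
  intro χ hχ
  obtain ⟨c, hfull, hcert, hU⟩ := hA χ hχ
  refine ⟨c, hfull.1, hfull.2.1, hfull.2.2.1, hcert, ?_⟩
  have hw : c.wellFormed = true := hcert.2.1
  unfold MaassHeckeTraceCensus.certifiesDeficit
  rcases Nat.lt_or_ge c.upperCount 1 with h0 | h1
  · have : c.upperCount = 0 := by omega
    simp [hw, this]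
  · have h1' : c.upperCount = 1 := le_antisymm hU h1
    have hv := hB χ hχ c hfull hcert h1'
    simp [hw, h1', hv]

/-- Conversely `D` does NOT hand back piece A or piece B (a deficit transcript may have `fpPrimes = [p]` or
`U = 0`); the split is one-way glue, recorded here only to show which piece inherits the content. What `D`
does imply is the weak consequence "some certified transcript with `U ≤ 1` exists per character". [folklore] -/
theorem exists_certified_upperCount_le_one_of_censusDeficit1951 (hD : CensusDeficit1951)
    (χ : DirichletCharacter ℂ 1951) (hχ : orderOf χ = 5) :
    ∃ c : MaassHeckeTraceCensus, CertifiedMaassHeckeTraceCensus 1951 χ c ∧ c.upperCount ≤ 1 := by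
  obtain ⟨c, -, -, -, hcert, hv⟩ := hD χ hχ
  refine ⟨c, hcert, ?_⟩
  unfold MaassHeckeTraceCensus.certifiesDeficit at hv
  simp only [Bool.and_eq_true, Bool.or_eq_true, beq_iff_eq] at hv
  rcases hv.2 with h | ⟨h, -⟩ <;> omega

/-! ## §3 Bookkeeping for the tribunal's closing motion -/

/-- The certificate that closes the crux `refuted` (landed p161038, lead c1): an odd window certificate for
one order-5 character — the parent crux stmt-Langlands-15897's computation-class output — refutes `D`.
Re-exported by name. [folklore] -/
theorem not_censusDeficit1951_of_oddWindowCertificate' (h : OddWindowCertificate) : ¬ CensusDeficit1951 :=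
  CensusDeficit1951_false_of_OddWindowCertificate h

/-- Two-sided calibration of record (p164134, lead c2), quoted: any kernel refutation of `D` constructs a
non-zero weight-0 Maass cusp form of level 1951 with order-5 nebentypus. [folklore] -/
example (h : ¬ CensusDeficit1951) :
    ∃ χ : DirichletCharacter ℂ 1951, orderOf χ = 5 ∧ ∃ (u : UpperHalfPlane → ℂ) (lam : ℝ),
      IsMaassCuspFormOn 1951 χ u lam ∧ u ≠ 0 :=
  Summit.Langlands.Langlands.Theorems.CensusDeficit1951.exists_cuspForm_ne_zero_of_not_CensusDeficit1951 h

end Summit.Langlands.Langlands.Cruxes.CensusDeficit1951.CensusR1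

end
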